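import Mathlib.NumberTheory.NumberField.Basic
import Mathlib.RingTheory.Int.Basic
import Mathlib.Data.ZMod.Basic
import Mathlib.Tactic.IntervalCases
import Mathlib.Tactic.FinCases
import Mathlib.Tactic.Ring
import HarnessLib

/-!
# Bertolini–Darmon admissible primes (Ann. of Math. 162 (2005), p. 18) and their vacuity at `p = 2, 3`

Topic `Literature/NumberTheory/EllipticCurves`. A published DEFINITION with a body and proved API; no named
fact, no `sorry`. Unit `b2b-bsdres-x11b3-lit1` (literature seat 1 of the cell `b2b-bsdres` team x11b3 = class
X11b at `p = 3`): the team's planners asked which step of the printed architectures for the anticyclotomic main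
conjecture at a multiplicative prime fails at `p = 3` ("the level-raising at 3?", `CLASS-CLOSURE-PLAN.md`
§3.10 E2). For the level-raising / bipartite-Euler-system architecture (Bertolini–Darmon 2005, Howard 2006,
Pollack–Weston 2011, W. Zhang 2014, Skinner–Zhang 2014) the answer is the arithmetic recorded here: its
auxiliary *admissible primes* `ℓ` must satisfy `p ∤ ℓ² − 1`, and for `p = 3` (or `p = 2`) no prime `ℓ`
does — the set of admissible primes is EMPTY, as Bertolini–Darmon note in print ("Note that here the
assumption that `p > 3` is needed", p. 22).

## Source, verbatim

M. Bertolini, H. Darmon, *Iwasawa's Main Conjecture for elliptic curves over anticyclotomic `ℤ_p`-extensions*,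
Ann. of Math. 162 (2005) 1–64 [BertoliniDarmon2005], p. 18: "**Admissible primes.** A rational prime `ℓ` is
said to be `n`-admissible relative to `f` if it satisfies the following conditions: (1) `ℓ` does not divide
`N = pN⁺N⁻`; (2) `ℓ` is inert in `K/ℚ`; (3) `p` does not divide `ℓ² − 1`; (4) `pⁿ` divides `ℓ + 1 − a_ℓ` or
`ℓ + 1 + a_ℓ`. A `1`-admissible prime will simply be called admissible (so that in particular any
`n`-admissible prime is admissible)." Context (p. 2): "Let `N₀` denote the conductor of `E`, set `N = pN₀` if
`E` has good ordinary reduction at `p`, and set `N = N₀` if `E` has multiplicative reduction at `p` so that `p`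
divides `N₀` exactly. … `K` determines a factorisation `N = pN⁺N⁻`"; `f` is the weight-two eigenform of `E`
with Hecke eigenvalues `a_ℓ` (§1.1). p. 22 (proof of Thm. 3.2, the supply of `n`-admissible primes by
Čebotarev): "The automorphism `T` has eigenvalues `δ` and `λ`, where `λ ∈ (ℤ/pⁿℤ)^×` is not equal to `±1`
mod `p` and has order prime to `p`. (Note that here the assumption that `p > 3` is needed.)"
The same definition, verbatim up to notation: B. Howard, *Bipartite Euler systems*, J. reine angew. Math. 597
(2006), Def. 3.1.1 ("A degree two prime `𝔩 ∤ N` of `K` is `k`-admissible if `N(𝔩) ≢ 1 (mod p)`, and if there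
is a decomposition `E[p^k] ≅ ℤ/p^kℤ ⊕ μ_{p^k}` of `Gal(K_𝔩^unr/K_𝔩)`-modules" — `N(𝔩) = ℓ²` for the inert `ℓ`
below `𝔩`) [Howard2006]; W. Zhang, Camb. J. Math. 2 (2014), p. 202 (xiv) ("a prime `q` is called admissible
if `q` is prime to `NDp`, inert in `K`, `p` does not divide `q² − 1`, and … `v_p((q+1)² − a_q²) ≥ 1`")
[WZhang2014], with Lemma 7.3 p. 232 "Assume `p ≥ 5`. … there exists a positive density of admissible primes";
Skinner–Zhang, arXiv:1407.1099 §2.11 [SkinnerZhang2014].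

## Transcription

* The coefficient system is an arbitrary function `a : ℕ → ℤ` (`a ℓ = a_ℓ(f)`; for an elliptic curve `E/ℚ`
  on a global minimal model `W` and a prime `ℓ` of good reduction, `a ℓ = W.frobeniusTrace ℓ` of
  `GlobalMinimalModel.lean`). Nothing about modular forms is needed to STATE (1)–(4).
* (1) "`ℓ ∤ N = pN⁺N⁻`": the level is passed as the conductor `N = N₀` of `E` and the condition is rendered
  `¬ ℓ ∣ p * N` — `pN⁺N⁻` and `pN₀` have the same prime divisors in both of BD's cases (`N₀ = N⁺N⁻` at good
  `p`, `N₀ = pN⁺N⁻` at multiplicative `p`).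
* (2) "`ℓ` inert in `K`": the ideal `ℓ𝓞_K` is prime — the tree's rendering of inertness, exactly as in
  `IsKolyvaginPrime` (`HeegnerPointsKolyvaginEulerSystem.lean`), for the ring of integers `𝓞 K` of Mathlib; `K` is
  any field in the definition (intended: an imaginary quadratic number field — BD's standing `(disc K, N) = 1`
  is a hypothesis on `K`, not part of admissibility; no `[NumberField K]` instance is needed to state it).
* (3), (4) over `ℤ` (no natural-number subtraction): `¬ (p : ℤ) ∣ ℓ² − 1`,
  `pⁿ ∣ ℓ + 1 − a ℓ ∨ pⁿ ∣ ℓ + 1 + a ℓ`.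

## Contents

* `IsAdmissiblePrime N K a p n ℓ` — the definition; `isAdmissiblePrime_iff`; projections; BD's remark
  "any `n`-admissible prime is admissible" (`IsAdmissiblePrime.of_le`, `IsAdmissiblePrime.one`).
* `int_dvd_sq_sub_one_iff` — for `p` prime, `p ∣ ℓ² − 1 ↔ p ∣ ℓ − 1 ∨ p ∣ ℓ + 1` (condition (3) says
  `ℓ ≢ ±1 (mod p)`).
* `three_dvd_sq_sub_one` — `3 ∣ ℓ² − 1` for every prime `ℓ ≠ 3` (and, privately, `2 ∣ ℓ² − 1` for odd `ℓ`).
* `not_isAdmissiblePrime_three`, `not_isAdmissiblePrime_two`, `setOf_isAdmissiblePrime_three_eq_empty`,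
  `three_lt_of_isAdmissiblePrime` — NO prime is admissible when `p = 3` (resp. `p = 2`), for any `N`, `K`, `a`,
  `n`: the printed "`p > 3` is needed". (At `p ≥ 5` clause (3) is not vacuous, e.g. `ℓ = 2`; the actual
  supply of admissible primes, BD05 Thm. 3.2 via Čebotarev, is NOT recorded here.)

What is NOT here: no theorem of [BertoliniDarmon2005] beyond the definition and its elementary arithmetic
(Thm. 3.2's Čebotarev supply, the level-raising Thm. 5.15/9.3, the main theorem — all with standing
Assumption 6 "(1) The prime `p` is `≥ 5` …", p. 4); no bipartite Euler system. The cell's dossier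
`HOME/b2b-bsdres-x11b3-lit1/HOWARD-CASTELLA-HYPOTHESES.md` §0 (II), §2, §7 has the verbatim context.
-/

namespace Literature.NumberTheory.EllipticCurves.BertoliniDarmon2005

open NumberField

universe u

section Definition

variable (N : ℕ) (K : Type u) [Field K] (a : ℕ → ℤ) (p n : ℕ)

/-- **Bertolini–Darmon `n`-admissible primes** (Ann. of Math. 162 (2005), p. 18), relative to the level
`N` (the conductor of `E`; BD's `N = pN⁺N⁻` has the same prime divisors as `pN`), the field `K`, the Hecke
eigenvalues `a` (`a ℓ = a_ℓ(f)`), the prime `p` and the exponent `n`. Printed: "A rational prime `ℓ` is said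
to be `n`-admissible relative to `f` if it satisfies the following conditions: (1) `ℓ` does not divide
`N = pN⁺N⁻`; (2) `ℓ` is inert in `K/ℚ`; (3) `p` does not divide `ℓ² − 1`; (4) `pⁿ` divides `ℓ + 1 − a_ℓ`
or `ℓ + 1 + a_ℓ`." Rendered as: `ℓ` prime; (1) `ℓ ∤ pN`; (2) `ℓ𝓞_K` is a prime ideal; (3) `¬ p ∣ ℓ² − 1`
in `ℤ`; (4) in `ℤ`. Same notion: Howard 2006 Def. 3.1.1 (`N(𝔩) ≢ 1 (mod p)`), W. Zhang 2014 p. 202 (xiv),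
Skinner–Zhang 2014 §2.11 (module docstring).
[cite: BertoliniDarmon2005, p. 18 (Admissible primes), §2.2] -/
def IsAdmissiblePrime (ℓ : ℕ) : Prop :=
  ℓ.Prime ∧ ¬ ℓ ∣ p * N ∧ (Ideal.span {(ℓ : 𝓞 K)}).IsPrime ∧
    ¬ ((p : ℤ) ∣ (ℓ : ℤ) ^ 2 - 1) ∧
    ((p : ℤ) ^ n ∣ (ℓ : ℤ) + 1 - a ℓ ∨ (p : ℤ) ^ n ∣ (ℓ : ℤ) + 1 + a ℓ)

variable {N K a p n}

/-- Unfolding of `IsAdmissiblePrime`. [cite: BertoliniDarmon2005, p. 18 (Admissible primes)] -/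
theorem isAdmissiblePrime_iff {ℓ : ℕ} : IsAdmissiblePrime N K a p n ℓ ↔
    ℓ.Prime ∧ ¬ ℓ ∣ p * N ∧ (Ideal.span {(ℓ : 𝓞 K)}).IsPrime ∧
      ¬ ((p : ℤ) ∣ (ℓ : ℤ) ^ 2 - 1) ∧
      ((p : ℤ) ^ n ∣ (ℓ : ℤ) + 1 - a ℓ ∨ (p : ℤ) ^ n ∣ (ℓ : ℤ) + 1 + a ℓ) :=
  Iff.rfl

/-- An admissible prime is a prime. [cite: BertoliniDarmon2005, p. 18 (Admissible primes)] -/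
theorem IsAdmissiblePrime.prime {ℓ : ℕ} (h : IsAdmissiblePrime N K a p n ℓ) : ℓ.Prime := h.1

/-- Condition (1): `ℓ ∤ pN`. [cite: BertoliniDarmon2005, p. 18 (Admissible primes) (1)] -/
theorem IsAdmissiblePrime.not_dvd {ℓ : ℕ} (h : IsAdmissiblePrime N K a p n ℓ) : ¬ ℓ ∣ p * N := h.2.1

/-- Condition (1) implies `ℓ ≠ p`. [cite: BertoliniDarmon2005, p. 18 (Admissible primes) (1)] -/
theorem IsAdmissiblePrime.ne {ℓ : ℕ} (h : IsAdmissiblePrime N K a p n ℓ) : ℓ ≠ p := by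
  rintro rfl
  exact h.not_dvd (dvd_mul_right ℓ N)

/-- Condition (2): `ℓ𝓞_K` is a prime ideal (`ℓ` is inert in `K`).
[cite: BertoliniDarmon2005, p. 18 (Admissible primes) (2)] -/
theorem IsAdmissiblePrime.isPrime_span {ℓ : ℕ} (h : IsAdmissiblePrime N K a p n ℓ) :
    (Ideal.span {(ℓ : 𝓞 K)}).IsPrime := h.2.2.1

/-- Condition (3): `p ∤ ℓ² − 1`. [cite: BertoliniDarmon2005, p. 18 (Admissible primes) (3)] -/
theorem IsAdmissiblePrime.not_dvd_sq_sub_one {ℓ : ℕ} (h : IsAdmissiblePrime N K a p n ℓ) :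
    ¬ ((p : ℤ) ∣ (ℓ : ℤ) ^ 2 - 1) := h.2.2.2.1

/-- Condition (4): `pⁿ ∣ ℓ + 1 − a_ℓ` or `pⁿ ∣ ℓ + 1 + a_ℓ`.
[cite: BertoliniDarmon2005, p. 18 (Admissible primes) (4)] -/
theorem IsAdmissiblePrime.pow_dvd {ℓ : ℕ} (h : IsAdmissiblePrime N K a p n ℓ) :
    (p : ℤ) ^ n ∣ (ℓ : ℤ) + 1 - a ℓ ∨ (p : ℤ) ^ n ∣ (ℓ : ℤ) + 1 + a ℓ := h.2.2.2.2

/-- **"Any `n`-admissible prime is `m`-admissible for `m ≤ n`"** — the monotonicity behind BD's remark "so that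
in particular any `n`-admissible prime is admissible" (only condition (4) depends on `n`, and `p^m ∣ p^n`).
[cite: BertoliniDarmon2005, p. 18 (Admissible primes)] -/
theorem IsAdmissiblePrime.of_le {ℓ m : ℕ} (h : IsAdmissiblePrime N K a p n ℓ) (hm : m ≤ n) :
    IsAdmissiblePrime N K a p m ℓ := by
  refine ⟨h.1, h.2.1, h.2.2.1, h.2.2.2.1, ?_⟩
  have hdvd : (p : ℤ) ^ m ∣ (p : ℤ) ^ n := pow_dvd_pow _ hm
  exact h.pow_dvd.imp (fun h' ↦ hdvd.trans h') (fun h' ↦ hdvd.trans h')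

/-- **BD's remark, as printed: an `n`-admissible prime (`n ≥ 1`) is admissible (= `1`-admissible).**
[cite: BertoliniDarmon2005, p. 18 (Admissible primes)] -/
theorem IsAdmissiblePrime.one {ℓ : ℕ} (h : IsAdmissiblePrime N K a p n ℓ) (hn : 1 ≤ n) :
    IsAdmissiblePrime N K a p 1 ℓ :=
  h.of_le hn

end Definition

/-! ## Condition (3): `p ∣ ℓ² − 1 ↔ ℓ ≡ ±1 (mod p)`, and its failure for every `ℓ` at `p = 2, 3` -/

section Arithmetic

/-- For a prime `p` and an integer `x`: `p ∣ x² − 1 ↔ p ∣ x − 1 ∨ p ∣ x + 1` (`x² − 1 = (x − 1)(x + 1)` and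
Euclid's lemma), i.e. condition (3) says `ℓ ≢ ±1 (mod p)` — the form in which [BertoliniDarmon2005] use it
(p. 18: "the Frobenius element … acts … with eigenvalues `±ℓ` and `±1` which are distinct modulo `p`"; p. 22:
"`λ` … is not equal to `±1` mod `p`"). [cite: BertoliniDarmon2005, p. 18 (after the definition) and p. 22] -/
theorem int_dvd_sq_sub_one_iff {p : ℕ} (hp : p.Prime) (x : ℤ) :
    (p : ℤ) ∣ x ^ 2 - 1 ↔ (p : ℤ) ∣ x - 1 ∨ (p : ℤ) ∣ x + 1 := by
  have hfac : x ^ 2 - 1 = (x - 1) * (x + 1) := by ring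
  rw [hfac]
  exact (Nat.prime_iff_prime_int.mp hp).dvd_mul

/-- Every element of `ZMod 3` other than `0` squares to `1` (private helper). [folklore] -/
private theorem zmod_three_sq_eq_one {x : ZMod 3} (hx : x ≠ 0) : x ^ 2 = 1 := by
  fin_cases x
  · exact absurd rfl hx
  · decide
  · decide

/-- **`3 ∣ ℓ² − 1` for every prime `ℓ ≠ 3`** (indeed for every integer prime to `3`): the arithmetic behind
Bertolini–Darmon's "Note that here the assumption that `p > 3` is needed" (p. 22: an element
"`λ ∈ (ℤ/pⁿℤ)^×` … not equal to `±1` mod `p`" must exist). [cite: BertoliniDarmon2005, p. 22 (proof of Thm. 3.2)] -/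
theorem three_dvd_sq_sub_one {ℓ : ℕ} (hℓ : ℓ.Prime) (h3 : ℓ ≠ 3) : (3 : ℤ) ∣ (ℓ : ℤ) ^ 2 - 1 := by
  have hnd : ¬ 3 ∣ ℓ := fun h ↦ h3 ((Nat.prime_dvd_prime_iff_eq Nat.prime_three hℓ).mp h).symm
  have hne : ((ℓ : ℤ) : ZMod 3) ≠ 0 := by
    rw [Int.cast_natCast, Ne, ZMod.natCast_eq_zero_iff]
    exact hnd
  have hsq : (((ℓ : ℤ) ^ 2 - 1 : ℤ) : ZMod 3) = 0 := by
    rw [Int.cast_sub, Int.cast_pow, Int.cast_one, zmod_three_sq_eq_one hne, sub_self]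
  exact (ZMod.intCast_zmod_eq_zero_iff_dvd _ 3).mp hsq

/-- `2 ∣ ℓ² − 1` for every prime `ℓ ≠ 2` (an odd square is odd; private helper). [folklore] -/
private theorem two_dvd_sq_sub_one {ℓ : ℕ} (hℓ : ℓ.Prime) (h2 : ℓ ≠ 2) : (2 : ℤ) ∣ (ℓ : ℤ) ^ 2 - 1 := by
  have hodd : Odd ℓ := hℓ.odd_of_ne_two h2
  have hodd' : Odd ((ℓ : ℤ) ^ 2) := (by exact_mod_cast hodd : Odd (ℓ : ℤ)).pow
  obtain ⟨k, hk⟩ := hodd'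
  exact ⟨k, by rw [hk]; ring⟩

end Arithmetic

/-! ## No admissible primes at `p = 3` (and `p = 2`) -/

section Vacuity

variable {N : ℕ} {K : Type u} [Field K] {a : ℕ → ℤ} {n : ℕ}

/-- **There are no Bertolini–Darmon admissible primes for `p = 3`**, whatever the level `N`, the field `K`,
the eigenvalues `a` and the exponent `n`: a candidate `ℓ = 3` violates (1) (`ℓ ∣ pN`), and every prime
`ℓ ≠ 3` violates (3) since `ℓ² ≡ 1 (mod 3)`. This is the printed remark "(Note that here the assumption that
`p > 3` is needed.)" of [BertoliniDarmon2005, p. 22] (and "Assume `p ≥ 5`" in W. Zhang 2014, Lemma 7.3),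
recorded as a theorem: the level-raising / bipartite-Euler-system architecture has an EMPTY set of auxiliary
primes at `p = 3` as defined in print. [cite: BertoliniDarmon2005, p. 22 (proof of Thm. 3.2)] -/
theorem not_isAdmissiblePrime_three (ℓ : ℕ) : ¬ IsAdmissiblePrime N K a 3 n ℓ := by
  intro h
  by_cases h3 : ℓ = 3
  · exact h.ne h3
  · exact h.not_dvd_sq_sub_one (by exact_mod_cast three_dvd_sq_sub_one h.prime h3)

/-- The set of admissible primes at `p = 3` is empty. [cite: BertoliniDarmon2005, p. 22 (proof of Thm. 3.2)] -/
theorem setOf_isAdmissiblePrime_three_eq_empty : {ℓ : ℕ | IsAdmissiblePrime N K a 3 n ℓ} = ∅ :=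
  Set.eq_empty_of_forall_notMem fun ℓ ↦ not_isAdmissiblePrime_three ℓ

/-- Likewise there are no admissible primes for `p = 2` (`ℓ = 2` violates (1); an odd prime has
`ℓ² ≡ 1 (mod 2)`) — the other half of the printed "`p > 3` is needed".
[cite: BertoliniDarmon2005, p. 22 (proof of Thm. 3.2)] -/
theorem not_isAdmissiblePrime_two (ℓ : ℕ) : ¬ IsAdmissiblePrime N K a 2 n ℓ := by
  intro h
  by_cases h2 : ℓ = 2
  · exact h.ne h2
  · exact h.not_dvd_sq_sub_one (by exact_mod_cast two_dvd_sq_sub_one h.prime h2)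

/-- Contrapositive form used by planners: if some prime is `n`-admissible for `(N, K, a, p)`, then `p ≠ 2` and
`p ≠ 3`. [cite: BertoliniDarmon2005, p. 22 (proof of Thm. 3.2)] -/
theorem three_lt_of_isAdmissiblePrime {p ℓ : ℕ} (hp : p.Prime) (h : IsAdmissiblePrime N K a p n ℓ) :
    3 < p := by
  by_contra hle
  rw [not_lt] at hle
  interval_cases p
  · exact hp.ne_zero rfl
  · exact Nat.not_prime_one hp
  · exact not_isAdmissiblePrime_two ℓ h
  · exact not_isAdmissiblePrime_three ℓ h

end Vacuity

end Literature.NumberTheory.EllipticCurves.BertoliniDarmon2005
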